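import Summits.ABC.IUTFork.Joshi.MochizukiAnsatzLocal
import Mathlib.RingTheory.Ideal.Maps
import HarnessLib

/-!
# Joshi, *ATS II (local prototype)* §6.2/§6.6 — the remaining clauses: the primitive ELEMENTS `[a^{j²}] − p` and their
# principal ideals (Prop. 6.2.1 (1)(2)), the images in `X_{F,ℚ_p} = Y_{F,ℚ_p}/φ^ℤ` (Prop. 6.2.1 (4)), Lem. 6.2.2 (every
# degree-one prime is the FIRST entry of an Ansatz tuple) and the Hecke-type divisorial correspondence of Rmk. 6.6.2

Record file of the abc-iut cell, branch E «type Joshi's construction, test vs S» (rung LADDER-ABC:A2.E; seat abc-iut-E-t2, gen 2;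
registry rows J2p:Prop6.2.1(1), J2p:Prop6.2.1(2), J2p:Prop6.2.1(4), J2p:Lem6.2.2, J2p:Rmk6.6.2 of plan/E/JOSHI-DAG.tsv — the
E-dag REMAINDER LIST of 2026-08-26T09:07:51Z). TAKES NO SIDE on [IUTchIII] Cor. 3.12, on Joshi's claims, or on Mochizuki's report on
them; typed ≠ proved ≠ endorsed. Source: K. Joshi, *Construction of Arithmetic Teichmuller Spaces II: Proof of a local prototype of
Mochizuki's Corollary 3.12*, arXiv:2303.01662 **v3** (UNREFEREED preprint; bib `Joshi2023ATS2Local`; cell render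
`HOME/lit/renders/Joshi-arxiv-2303.01662/pNNNN.txt`, locators «p. N l. a–b» = PDF page N, render line).

CARRIERS (BY NAME, nothing re-typed — E-PLAN R4a/R12): abc-iut-E-t3's `PeriodRingDatum` / `PrototypeDatum` (`Joshi/ThetaValuesLocus`,
`Joshi/PrimitiveAnsatz`: the Teichmüller map `teich`, the point map `pt` («the point `y_a` of `[a] − p`»), `frobY`, `galY`,
`η_{K_y}`, the parameters `AnsatzParam`, the tuple `ansatzPt`, the PRIMITIVE ANSATZ `primitiveAnsatz` of Def. 6.2.3 with Prop.
6.6.1 / 6.7.1 / Thm. 6.9.1 DERIVED there) and my `PeriodRingDatum.EtaPtTeich` (`Joshi/MochizukiAnsatzLocal`, the named hypothesis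
«`η_{K_{y_a}}([a]) = p`» of Lem. 6.10.1). The parent row J2p:Prop6.2.1 (and its clause (3), the POINTS `y_j`) is E-t3's `ansatzPt`
(p428639). This file does NOT import OUR side (R14); no bearing on S is claimed — these are carrier-completeness rows.

## Contents (as printed ↦ as typed; SIGNATURE/DEFINITION = data Joshi fixes, HYPOTHESIS = a statement print asserts or imports
## from [FF18], typed `def … : Prop` with `@[claim "Joshi2023ATS2Local" "disputed"]` and never asserted, DERIVED = a `theorem`)

* Prop. 6.2.1 (1) (p. 14 l. 53–57) «one has primitive elements of degree one given by `[a^{j²}] − p ∈ W(𝒪_F)`» ↦ the ELEMENTS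
  `PeriodRingDatum.primElt a = [a] − p` and `PrototypeDatum.ansatzElt a i = [a^{(i+1)²}] − p` of `B ⊇ W(𝒪_F)` (DEFINITIONS; `W(𝒪_F)`
  is not a separate carrier of the signature — READING: the elements are typed in `B`); «primitive of degree one» is, on the
  signature, exactly the admissibility `a^{j²} ∈ 𝔪_F ∖ 0` of the parameter (E-t3's `pow_mem_ansatzParam`, restated as
  `ansatzParam_pow_sq`); DERIVED from `EtaPtTeich`: `η_{K_{y_a}}([a] − p) = 0` (`eta_pt_primElt`, `eta_ansatzPt_ansatzElt`) — the
  point `y_a` IS the zero of the element, i.e. the coherence of clauses (1)–(3).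
* Prop. 6.2.1 (2) (p. 14 l. 58–60) «Each of these elements generates a principal prime ideal `𝔭_j = ([a^{j²}] − p) ⊂ W(𝒪_F)`» ↦
  `primIdeal a := Ideal.span {[a] − p}`, `ansatzIdeal a i` (DEFINITIONS, ideals of `B`; primality in `W(𝒪_F)` = [FF18, Lem. 2.2.14]
  is not typed — no `W(𝒪_F)` carrier); DERIVED: `𝔭_j ≤ ker η_{K_{y_j}}` (`primIdeal_le_ker`, `ansatzIdeal_le_ker`; proof of Prop.
  6.2.1, p. 15 l. 8–13: «its extension to `W(𝒪_F) ⊂ B` provides a closed maximal ideal of `B` and hence a closed classical point»).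
* Prop. 6.2.1 (4) (p. 15 l. 1–5) «For each `y_j` one may consider its image under the canonical morphism `Y_{ℂ_p^♭,ℚ_p} → X_{ℂ_p^♭,ℚ_p}`
  and view `y_j` as providing a closed classical point of `X`»; §6.6 (p. 16 l. 29–36): the fibre of `Y → X` over a point is a
  Frobenius orbit `{([φⁿ(t)] − p) : n ∈ ℤ}` ↦ `PeriodRingDatum.XPt := Quot (φ-step)`, `toX : Y → XPt` (READING: E-t3's `frobY` is a
  bare map with no inverse posited, so `X` is typed as the quotient by the equivalence relation GENERATED by `y ~ φ(y)`; for the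
  bijective `φ` of print this is `Y/φ^ℤ`; the twin over E-t1's carrier is `UntiltPoints.XPt`, `Joshi/ArithTeichmullerFrobenius`);
  DERIVED: `toX ∘ φ = toX` (`toX_frobY`, `toX_frobY_iterate`), `toX (y_{a^p}) = toX (y_a)` (`toX_pt_pow_p`), the images
  `ansatzXPt a i` and their invariance under the Frobenius translates of Prop. 6.6.1 (`ansatzXPt_pow_p`, `ansatzXPt_pow_p_pow`:
  the tuples of `a` and of `φⁿ(a) = a^{pⁿ}` have the same images in `X^{ℓ⋆}` — the fact behind Prop. 6.7.1's «any point in the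
  Frobenius orbit of the canonical tuple has … image of its first coordinate … the canonical point of `X`»).
* Lem. 6.2.2 (p. 15 l. 15–26) «Let `𝔭 ⊂ W(𝒪_F)` be a principal (prime) ideal generated by some primitive element of degree one. Then
  there is a tuple of principal prime ideals `(𝔭_1, …, 𝔭_{ℓ⋆})` of the sort constructed in Proposition 6.2.1 with `𝔭 = 𝔭_1`.
  Proof. … by [FF18, Corollaire 2.2.9] one can find a unit `u` and an `a ∈ 𝔪_F − {0}` such that `α·u = [a] − p` …» ↦ the cited
  input as the HYPOTHESIS `PeriodRingDatum.PtSurjective` («every point of `Y` is `y_a` for some `0 ≠ a ∈ 𝔪_F`», named, never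
  asserted) and the lemma DERIVED from it at the level the signature has — points (`exists_tuple_first_eq`: every `y` is the FIRST
  coordinate of a tuple of `Σ̃_F`) — together with its parameter form, hypothesis-free (`exists_tuple_first_eq_pt`,
  `ansatzPt_first`, `ansatzIdeal_first`: the tuple of `a` starts with `y_a`, resp. with `([a] − p)`).
  **AUTHOR'S VACUITY NOTE (same session; kernel in `Joshi/PrimitiveAnsatzPointsClassical`):** over ALL of the carrier TYPE `Y`,
  `PtSurjective` is REFUTABLE for every datum (`not_ptSurjective`: `pt` is total and `pt_frob` holds at `a = 1`, so the junk value `pt 1`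
  is φ-fixed; no `y_a` is) — `exists_tuple_first_eq`, `heckeImage_nonempty`, `exists_idealTuple_first` are VACUOUS, SUPERSEDED there by
  hypothesis-free `…_of_mem` versions on the degree-one locus `classicalPts = {y_a}` (print's `|Y|`: no φ-fixed points, §6.6).
* Rmk. 6.6.2 (p. 16 l. 70–75) «One should think of the assignment `([a] − p) ↦ ([a^{1²}] − p), ([a^{2²}] − p), …, ([a^{ℓ⋆²}] − p)` as
  divisorial correspondence `Y ⇢ Y` (resp. `X ⇢ X`) in the sense of a Hecke correspondence between modular curves» (cf. §6.12.1
  p. 19 l. 43–49, the «formal sum of points») ↦ the RELATION `heckeCorr ⊆ Y × Y` generated by the parameters, `{(y_a, y_{a^{j²}})}`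
  (DEFINITION, one-to-many as printed; whether it is single-valued on POINTS rather than on parameters is not claimed by print
  and not typed), its fibres `heckeImage y`, and its descent `heckeCorrX ⊆ X × X`; DERIVED: `y_a ↦ y_a` is in it (the `j = 1`
  term), it is Frobenius- and Galois-EQUIVARIANT (`heckeCorr_frob`, `heckeCorr_gal`, from E-t3's `pt_frob`/`pt_gal` — this is
  what makes «resp. `X ⇢ X`» meaningful: `heckeCorrX` is the image relation and `toX`-pairs of φ-translates coincide), every
  fibre is nonempty under `PtSurjective`, and — the link to Thm. 6.9.1 (E-t3's `scale_ansatzPt`) — ALONG THE CORRESPONDENCE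
  VALUATIONS ARE MULTIPLIED BY SQUARES: `(y, y′) ∈ heckeCorr → ∃ j ∈ [1, ℓ⋆], scale y′ = j²·scale y` (`exists_scale_eq_sq_mul`).

OUR-SIDE NEAREST OBJECTS (docstring record only, E-PLAN §3; the block-E test of this slot is `Joshi/TestATS2Reading` p429844/p430243,
outcome FILLS-MODULO-Y with Y = `Joshi.ATS2.PilotReading.QSide`): the correspondence `y_a ↦ (y_{a^{j²}})_j` is the move gen-0 located
as a VALUATION RESCALING at each label `j` (`exists_scale_eq_sq_mul` below is that statement on the relation), realised by no
element of `⟨(Ind1) ∪ (Ind2)⟩` at the pinned countermodel (`Cor312Vol.pinnedSetting_not_pilotKummerIndRelated`); `X`-images ↔ nothing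
on OUR side (the log-theta-lattice has no Frobenius quotient of its vertical lines). [claim: Joshi2023ATS2Local, status: disputed]
-/

noncomputable section

open Set

namespace Summit.ABC.IUTFork.Joshi

variable {F B E0 : Type} [Field F] [CommRing B] [Field E0] {Y : Type} {K : Y → Type} [∀ y, Field (K y)] {G : Type}

/-! ## 1. Prop. 6.2.1 (1)(2) over the signature: the elements `[a] − p`, their ideals, and the zero `y_a` -/

namespace PeriodRingDatum

variable (D : PeriodRingDatum F B E0 Y K G)

/-- **Prop. 6.2.1 (1) (p. 14 l. 53–57), the element** `[a] − p ∈ W(𝒪_F) ⊆ B` («primitive elements of degree one given by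
`[a^{j²}] − p ∈ W(𝒪_F)`»; here for a general parameter, the tuple version is `PrototypeDatum.ansatzElt`). DEFINITION, typed in `B`
(READING: `W(𝒪_F)` is not a separate carrier of E-t3's signature). [claim: Joshi2023ATS2Local, status: disputed] -/
def primElt (a : F) : B := D.teich a - (D.p : B)

/-- `[a] − p` unfolds as typed. [folklore] -/
theorem primElt_def (a : F) : D.primElt a = D.teich a - (D.p : B) := rfl

/-- **The point `y_a` is the zero of `[a] − p`**: `η_{K_{y_a}}([a] − p) = 0` for `0 ≠ a ∈ 𝔪_F` (proof of Prop. 6.2.1, p. 15 l. 8–13;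
§6.10 p. 18 l. 12–15 «generates the prime ideal `ker(η_K : W(𝒪_F) ↠ 𝒪_K)` defining the point»). DERIVED from the hypothesis
`EtaPtTeich` (`η_{K_{y_a}}([a]) = p`). [claim: Joshi2023ATS2Local, status: disputed] -/
theorem eta_pt_primElt (h : D.EtaPtTeich) {a : F} (ha0 : a ≠ 0) (ha : D.absF a < 1) :
    D.eta (D.pt a) (D.primElt a) = 0 := by
  rw [primElt_def, map_sub, h a ha0 ha, map_natCast, sub_self]

/-- Equivalently `[a] − p ∈ ker η_{K_{y_a}}`. DERIVED. [claim: Joshi2023ATS2Local, status: disputed] -/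
theorem primElt_mem_ker (h : D.EtaPtTeich) {a : F} (ha0 : a ≠ 0) (ha : D.absF a < 1) :
    D.primElt a ∈ RingHom.ker (D.eta (D.pt a)) :=
  (RingHom.mem_ker).2 (D.eta_pt_primElt h ha0 ha)

/-- **Prop. 6.2.1 (2) (p. 14 l. 58–60), the principal ideal** `([a] − p)` («Each of these elements generates a principal prime ideal
`𝔭_j = ([a^{j²}] − p) ⊂ W(𝒪_F)`»; p. 15 l. 10–12 «its extension to `W(𝒪_F) ⊂ B` provides a closed maximal ideal of `B`»). DEFINITION:
the ideal of `B` SPANNED by the element (primality / maximality = [FF18, Lem. 2.2.14], not typed). [claim: Joshi2023ATS2Local, status: disputed] -/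
def primIdeal (a : F) : Ideal B := Ideal.span {D.primElt a}

/-- The generator lies in its ideal. [folklore] -/
theorem primElt_mem_primIdeal (a : F) : D.primElt a ∈ D.primIdeal a := Ideal.subset_span rfl

/-- The ideal is principal, generated by `[a] − p`: membership is divisibility by the generator. [folklore] -/
theorem mem_primIdeal_iff (a : F) (b : B) : b ∈ D.primIdeal a ↔ D.primElt a ∣ b := by
  rw [primIdeal, Ideal.mem_span_singleton]

/-- **(2) ⇒ (3) of Prop. 6.2.1 in the kernel**: `([a] − p) ≤ ker η_{K_{y_a}}` — the ideal `𝔭_a` cuts out the point `y_a`. DERIVED from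
`EtaPtTeich`. [claim: Joshi2023ATS2Local, status: disputed] -/
theorem primIdeal_le_ker (h : D.EtaPtTeich) {a : F} (ha0 : a ≠ 0) (ha : D.absF a < 1) :
    D.primIdeal a ≤ RingHom.ker (D.eta (D.pt a)) := by
  rw [primIdeal, Ideal.span_le, Set.singleton_subset_iff]
  exact D.primElt_mem_ker h ha0 ha

/-- Every element of `𝔭_a` vanishes at `y_a`. DERIVED. [claim: Joshi2023ATS2Local, status: disputed] -/
theorem eta_pt_eq_zero_of_mem_primIdeal (h : D.EtaPtTeich) {a : F} (ha0 : a ≠ 0) (ha : D.absF a < 1) {b : B}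
    (hb : b ∈ D.primIdeal a) : D.eta (D.pt a) b = 0 :=
  (RingHom.mem_ker).1 (D.primIdeal_le_ker h ha0 ha hb)

/-! ## 2. Prop. 6.2.1 (4): the points of `X_{F,ℚ_p} = Y_{F,ℚ_p}/φ^ℤ` over the signature -/

/-- **The closed classical points of `X_{F,ℚ_p}`** as the quotient of those of `Y_{F,ℚ_p}` by Frobenius (Prop. 6.2.1 (4), p. 15 l. 1–5:
«its image under the canonical morphism `Y_{ℂ_p^♭,ℚ_p} → X_{ℂ_p^♭,ℚ_p}`»; §6.6 p. 16 l. 29–36: the fibre over a point of `X` «can be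
identified with the set of prime ideals … `{([φⁿ(t)] − p) ⊂ W(𝒪_{ℂ_p^♭}) : n ∈ ℤ}`»). DEFINITION — READING: E-t3's `frobY : Y → Y` is a
bare map (no inverse posited, cf. `Joshi/LogLinkColumn`), so `X` is the quotient by the equivalence relation GENERATED by the step
`y ~ φ(y)`; for the bijective `φ` of [FF18] this is exactly `Y/φ^ℤ`. Twin over E-t1's carrier: `UntiltPoints.XPt`
(`Joshi/ArithTeichmullerFrobenius`). [claim: Joshi2023ATS2Local, status: disputed] -/
def XPt : Type := Quot fun y y' : Y => D.frobY y = y'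

/-- **The canonical morphism `Y → X` on closed classical points** (Prop. 6.2.1 (4)). DEFINITION. [claim: Joshi2023ATS2Local, status: disputed] -/
def toX (y : Y) : D.XPt := Quot.mk _ y

/-- `Y → X` is onto (every point of `X` has a point of `Y` over it). [folklore] -/
theorem toX_surjective : Function.Surjective D.toX := Quot.mk_surjective

/-- `φ(y)` and `y` have the same image in `X` (§6.6: the fibres of `Y → X` are Frobenius orbits). DERIVED. [claim: Joshi2023ATS2Local, status: disputed] -/
theorem toX_frobY (y : Y) : D.toX (D.frobY y) = D.toX y :=
  (Quot.sound (r := fun y y' : Y => D.frobY y = y') rfl).symm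

/-- All forward Frobenius iterates of `y` lie over the same point of `X`. DERIVED. [claim: Joshi2023ATS2Local, status: disputed] -/
theorem toX_frobY_iterate (y : Y) (n : ℕ) : D.toX (D.frobY^[n] y) = D.toX y := by
  induction n with
  | zero => rfl
  | succ n ih => rw [Function.iterate_succ_apply', toX_frobY, ih]

/-- `y_{a^p} = φ(y_a)` lies over the same point of `X` as `y_a` (E-t3's `pt_frob`: «`φ([a] − p) = [a^p] − p`»). DERIVED.
[claim: Joshi2023ATS2Local, status: disputed] -/
theorem toX_pt_pow_p (a : F) : D.toX (D.pt (a ^ D.p)) = D.toX (D.pt a) := by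
  rw [D.pt_frob, toX_frobY]

/-- `y_{a^{pⁿ}}` lies over the same point of `X` as `y_a` (§6.6: the orbit `{([φⁿ(t)] − p)}`, forward half). DERIVED.
[claim: Joshi2023ATS2Local, status: disputed] -/
theorem toX_pt_pow_p_pow (a : F) (n : ℕ) : D.toX (D.pt (a ^ D.p ^ n)) = D.toX (D.pt a) := by
  induction n with
  | zero => rw [pow_zero, pow_one]
  | succ n ih => rw [pow_succ, pow_mul, toX_pt_pow_p, ih]

/-! ## 3. The [FF18] input of Lem. 6.2.2, as a named hypothesis -/

/-- **The input of Lem. 6.2.2** (p. 15 l. 18–23: «by [Fargues and Fontaine, 2018, Corollaire 2.2.9] one can find a unit `u ∈ W(𝒪_F)^*`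
and an `a ∈ 𝔪_F − {0}` such that `α·u = [a] − p` … Hence `𝔭 = (α) = ([a] − p)`»), at the level of the signature: every closed
classical point of `Y_{F,ℚ_p}` (= every principal prime generated by a primitive degree-one element, §2 / Prop. 6.2.1) is the point
`y_a` of some parameter `0 ≠ a ∈ 𝔪_F`. HYPOTHESIS on the carrier (E-t3's `PeriodRingDatum` posits the map `pt` but not its
surjectivity), named, never asserted. **REFUTABLE AS TYPED** over the whole TYPE `Y` (author, same session: `not_ptSurjective` in
`Joshi/PrimitiveAnsatzPointsClassical` — the junk value `pt 1` is φ-fixed; the consistent reading is the degree-one locus `classicalPts`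
there); kept unchanged (append-only tree) as the record of the defect. [claim: Joshi2023ATS2Local, status: disputed] -/
@[claim "Joshi2023ATS2Local" "disputed"]
def PtSurjective : Prop := ∀ y : Y, ∃ a : F, a ≠ 0 ∧ D.absF a < 1 ∧ D.pt a = y

end PeriodRingDatum

/-! ## 4. The tuple versions over the Primitive Ansatz (Prop. 6.2.1 (1)(2)(4) with the index `j`), Lem. 6.2.2 -/

namespace PrototypeDatum

variable (P : PrototypeDatum F B E0 Y K G)

/-- The first index `j = 1` of an `ℓ⋆`-tuple (`ℓ⋆ ≥ 1`; the last one is `PrototypeDatum.lastIdx` of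
`Joshi/StandardPointNormsSupply`). [folklore] -/
def firstIdx : Fin P.lstar := ⟨0, P.one_le_lstar⟩

/-- `firstIdx` is the index `0` (printed `j = 1`). [folklore] -/
theorem firstIdx_val : ((P.firstIdx : Fin P.lstar) : ℕ) = 0 := rfl

/-- The exponent at the first index is `1² = 1`. [folklore] -/
theorem first_exponent : ((P.firstIdx : ℕ) + 1) ^ 2 = 1 := by rw [firstIdx_val]; norm_num

/-- **Prop. 6.2.1 (1), the `j`-th element** `[a^{j²}] − p ∈ W(𝒪_F) ⊆ B` of the tuple of `a`, `j = i + 1` (p. 14 l. 53–57). DEFINITION.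
[claim: Joshi2023ATS2Local, status: disputed] -/
def ansatzElt (a : F) (i : Fin P.lstar) : B := P.primElt (a ^ ((i : ℕ) + 1) ^ 2)

/-- **Prop. 6.2.1 (1), admissibility**: with `a`, each `a^{j²}` is again a parameter `∈ 𝔪_F ∖ 0` — on the signature this IS «`[a^{j²}] − p`
is primitive of degree one» (constant Teichmüller coefficient `a^{j²} ≠ 0` of absolute value `< 1`). E-t3's `pow_mem_ansatzParam`,
restated at the tuple exponents. DERIVED. [claim: Joshi2023ATS2Local, status: disputed] -/
theorem ansatzParam_pow_sq {a : F} (ha : a ∈ P.AnsatzParam) (i : Fin P.lstar) :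
    a ^ ((i : ℕ) + 1) ^ 2 ∈ P.AnsatzParam :=
  P.pow_mem_ansatzParam ha (by positivity)

/-- The `j`-th point of E-t3's tuple is the point of the `j`-th parameter power (Prop. 6.2.1 (3) ↔ (1)). [folklore] -/
theorem ansatzPt_eq_pt (a : F) (i : Fin P.lstar) : P.ansatzPt a i = P.pt (a ^ ((i : ℕ) + 1) ^ 2) := rfl

/-- **(1) ↔ (3) coherence**: the `j`-th point `y_j` is the zero of the `j`-th element, `η_{K_{y_j}}([a^{j²}] − p) = 0`. DERIVED from
`EtaPtTeich` (cf. my `eta_teich_ansatzPt`, Lem. 6.10.1). [claim: Joshi2023ATS2Local, status: disputed] -/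
theorem eta_ansatzPt_ansatzElt (h : P.EtaPtTeich) {a : F} (ha : a ∈ P.AnsatzParam) (i : Fin P.lstar) :
    P.eta (P.ansatzPt a i) (P.ansatzElt a i) = 0 :=
  P.eta_pt_primElt h (P.ansatzParam_pow_sq ha i).1 (P.ansatzParam_pow_sq ha i).2

/-- **Prop. 6.2.1 (2), the `j`-th principal ideal** `𝔭_j = ([a^{j²}] − p)` (p. 14 l. 58–60). DEFINITION (ideal of `B` spanned by the
element). [claim: Joshi2023ATS2Local, status: disputed] -/
def ansatzIdeal (a : F) (i : Fin P.lstar) : Ideal B := P.primIdeal (a ^ ((i : ℕ) + 1) ^ 2)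

/-- The `j`-th element generates the `j`-th ideal. [folklore] -/
theorem ansatzElt_mem_ansatzIdeal (a : F) (i : Fin P.lstar) : P.ansatzElt a i ∈ P.ansatzIdeal a i :=
  P.primElt_mem_primIdeal _

/-- **(2) ⇒ (3) in the kernel**: `𝔭_j ≤ ker η_{K_{y_j}}` — «hence each `𝔭_j` defines a closed classical point `y_j`» (p. 14 l. 61).
DERIVED from `EtaPtTeich`. [claim: Joshi2023ATS2Local, status: disputed] -/
theorem ansatzIdeal_le_ker (h : P.EtaPtTeich) {a : F} (ha : a ∈ P.AnsatzParam) (i : Fin P.lstar) :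
    P.ansatzIdeal a i ≤ RingHom.ker (P.eta (P.ansatzPt a i)) :=
  P.primIdeal_le_ker h (P.ansatzParam_pow_sq ha i).1 (P.ansatzParam_pow_sq ha i).2

/-- The tuple of `a` STARTS with `[a] − p` itself (`1² = 1`). [folklore] -/
theorem ansatzElt_first (a : F) : P.ansatzElt a P.firstIdx = P.primElt a := by
  rw [ansatzElt, first_exponent, pow_one]

/-- … with the ideal `([a] − p)` itself (Lem. 6.2.2's «`𝔭 = 𝔭_1`», parameter form). [folklore] -/
theorem ansatzIdeal_first (a : F) : P.ansatzIdeal a P.firstIdx = P.primIdeal a := by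
  rw [ansatzIdeal, first_exponent, pow_one]

/-- … and with the point `y_a` itself. [folklore] -/
theorem ansatzPt_first (a : F) : P.ansatzPt a P.firstIdx = P.pt a := by
  rw [ansatzPt_eq_pt, first_exponent, pow_one]

/-- **Prop. 6.2.1 (4), the `j`-th point viewed in `X`**: the image of `y_j` under `Y → X`. DEFINITION. [claim: Joshi2023ATS2Local, status: disputed] -/
def ansatzXPt (a : F) (i : Fin P.lstar) : P.XPt := P.toX (P.ansatzPt a i)

/-- **Prop. 6.2.1 (4) with Prop. 6.6.1**: the tuple of `φ(a) = a^p` (the Frobenius translate of the tuple of `a`, E-t3's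
`primitiveAnsatz_frob`: «`[φⁿ(a^{j²})] − p = [b^{j²}] − p`») has the SAME images in `X^{ℓ⋆}`. DERIVED. [claim: Joshi2023ATS2Local, status: disputed] -/
theorem ansatzXPt_pow_p (a : F) (i : Fin P.lstar) : P.ansatzXPt (a ^ P.p) i = P.ansatzXPt a i := by
  unfold ansatzXPt
  rw [ansatzPt_eq_pt, ansatzPt_eq_pt, ← pow_mul, mul_comm, pow_mul, P.toX_pt_pow_p]

/-- The same for all forward iterates `φⁿ(a) = a^{pⁿ}` (§6.6/§6.7: the Frobenius orbit of a tuple lies over ONE tuple of points of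
`X` — for the canonical tuple (6.5.1), over the canonical point in the first coordinate, Prop. 6.7.1). DERIVED.
[claim: Joshi2023ATS2Local, status: disputed] -/
theorem ansatzXPt_pow_p_pow (a : F) (n : ℕ) (i : Fin P.lstar) : P.ansatzXPt (a ^ P.p ^ n) i = P.ansatzXPt a i := by
  induction n with
  | zero => rw [pow_zero, pow_one]
  | succ n ih => rw [pow_succ, pow_mul, ansatzXPt_pow_p, ih]

/-- The images in `X` of a Frobenius-translated tuple of points are those of the tuple (for ANY tuple, in particular on `Σ̃_F`,
which is `φ`-stable by E-t3's `primitiveAnsatz_frob`). DERIVED. [claim: Joshi2023ATS2Local, status: disputed] -/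
theorem toX_frobY_tuple (y : Fin P.lstar → Y) : (fun i => P.toX (P.frobY (y i))) = fun i => P.toX (y i) :=
  funext fun i => P.toX_frobY (y i)

/-- **Lem. 6.2.2, parameter form (hypothesis-free)**: the point `y_a` of a parameter is the FIRST coordinate of a tuple of `Σ̃_F`,
namely of the tuple of `a` (p. 15 l. 24–26: «one has the `ℓ⋆`-tuple … `𝔭_j = ([a^{j²}] − p)` … with `𝔭 = 𝔭_1` as asserted»). DERIVED.
[claim: Joshi2023ATS2Local, status: disputed] -/
theorem exists_tuple_first_eq_pt {a : F} (ha : a ∈ P.AnsatzParam) :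
    ∃ t ∈ P.primitiveAnsatz, t P.firstIdx = P.pt a :=
  ⟨P.ansatzPt a, ⟨a, ha, rfl⟩, P.ansatzPt_first a⟩

/-- **Lem. 6.2.2 (p. 15 l. 15–17)**: «Let `𝔭 ⊂ W(𝒪_F)` be a principal (prime) ideal generated by some primitive element of degree one.
Then there is a tuple of principal prime ideals `(𝔭_1, 𝔭_2, …, 𝔭_{ℓ⋆})` of the sort constructed in Proposition 6.2.1 with `𝔭 = 𝔭_1`.»
Point level: every point of `Y` is the first coordinate of a tuple of the Primitive Ansatz. DERIVED from `PtSurjective` — VACUOUS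
(`not_ptSurjective`); SUPERSEDED by `exists_tuple_first_eq_of_mem` (`Joshi/PrimitiveAnsatzPointsClassical`). [claim: Joshi2023ATS2Local, status: disputed] -/
theorem exists_tuple_first_eq (h : P.PtSurjective) (y : Y) : ∃ t ∈ P.primitiveAnsatz, t P.firstIdx = y := by
  obtain ⟨a, ha0, ha, rfl⟩ := h y
  exact P.exists_tuple_first_eq_pt ⟨ha0, ha⟩

/-- **Lem. 6.2.2, ideal form**: under `PtSurjective` every point `y` has a parameter `a` with `y = y_a`, and then the tuple of ideals
`(𝔭_j)_j = (([a^{j²}] − p))_j` starts with `([a] − p)`, all of whose elements vanish at `y` (given `EtaPtTeich`). DERIVED — VACUOUS in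
`h` (`not_ptSurjective`); SUPERSEDED by `exists_idealTuple_first_of_mem` (`Joshi/PrimitiveAnsatzPointsClassical`). [claim: Joshi2023ATS2Local, status: disputed] -/
theorem exists_idealTuple_first (h : P.PtSurjective) (hη : P.EtaPtTeich) (y : Y) :
    ∃ a ∈ P.AnsatzParam, P.pt a = y ∧ P.ansatzIdeal a P.firstIdx = P.primIdeal a ∧
      ∀ b ∈ P.primIdeal a, P.eta (P.pt a) b = 0 := by
  obtain ⟨a, ha0, ha, rfl⟩ := h y
  exact ⟨a, ⟨ha0, ha⟩, rfl, P.ansatzIdeal_first a, fun b hb => P.eta_pt_eq_zero_of_mem_primIdeal hη ha0 ha hb⟩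

/-! ## 5. Rmk. 6.6.2: the Hecke-type divisorial correspondence `Y ⇢ Y`, its equivariance, its descent to `X`, its scaling -/

/-- **Rmk. 6.6.2 (p. 16 l. 70–75) — the divisorial correspondence `Y ⇢ Y`** «`([a] − p) ↦ ([a^{1²}] − p), ([a^{2²}] − p), …, ([a^{ℓ⋆²}] − p)`
… in the sense of a Hecke correspondence between modular curves» (cf. §6.12.1 p. 19 l. 43–49: «one should write (6.11.2) in the
divisorial notation as formal sum of "points"»). DEFINITION: the relation on `Y` GENERATED BY THE PARAMETERS, `y_a ~ y_{a^{j²}}`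
(`a ∈ 𝔪_F ∖ 0`, `1 ≤ j ≤ ℓ⋆`) — one-to-many, as the printed «assignment»; single-valuedness on points (independence of the choice of
`a` with `𝔭 = ([a] − p)`) is neither claimed by print nor typed. [claim: Joshi2023ATS2Local, status: disputed] -/
def heckeCorr : Set (Y × Y) := {q | ∃ a ∈ P.AnsatzParam, ∃ i : Fin P.lstar, q = (P.pt a, P.ansatzPt a i)}

/-- The divisor of `y` under the correspondence: all `y′` with `(y, y′)` related (the support of the «formal sum»). DEFINITION.
[claim: Joshi2023ATS2Local, status: disputed] -/
def heckeImage (y : Y) : Set Y := {y' | (y, y') ∈ P.heckeCorr}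

/-- Membership in a fibre, unfolded. [folklore] -/
theorem mem_heckeImage_iff (y y' : Y) : y' ∈ P.heckeImage y ↔ (y, y') ∈ P.heckeCorr := Iff.rfl

/-- Each coordinate `y_{a^{j²}}` of the tuple of `a` is a correspondent of `y_a`. [folklore] -/
theorem ansatzPt_mem_heckeImage {a : F} (ha : a ∈ P.AnsatzParam) (i : Fin P.lstar) :
    P.ansatzPt a i ∈ P.heckeImage (P.pt a) :=
  ⟨a, ha, i, rfl⟩

/-- The `j = 1` term: `y_a` is a correspondent of itself. [folklore] -/
theorem pt_mem_heckeImage {a : F} (ha : a ∈ P.AnsatzParam) : P.pt a ∈ P.heckeImage (P.pt a) := by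
  have h := P.ansatzPt_mem_heckeImage ha P.firstIdx
  rwa [ansatzPt_first] at h

/-- The whole tuple of `a` lies in the divisor of `y_a`. [folklore] -/
theorem range_ansatzPt_subset_heckeImage {a : F} (ha : a ∈ P.AnsatzParam) :
    Set.range (P.ansatzPt a) ⊆ P.heckeImage (P.pt a) := by
  rintro _ ⟨i, rfl⟩
  exact P.ansatzPt_mem_heckeImage ha i

/-- Under the [FF18] input of Lem. 6.2.2 every point has a nonempty divisor (it contains the point itself). DERIVED — VACUOUS in `h`
(`not_ptSurjective`); SUPERSEDED by `heckeImage_nonempty_of_mem` (`Joshi/PrimitiveAnsatzPointsClassical`). [claim: Joshi2023ATS2Local, status: disputed] -/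
theorem heckeImage_nonempty (h : P.PtSurjective) (y : Y) : (P.heckeImage y).Nonempty := by
  obtain ⟨a, ha0, ha, rfl⟩ := h y
  exact ⟨_, P.pt_mem_heckeImage ⟨ha0, ha⟩⟩

/-- **The correspondence is FROBENIUS-EQUIVARIANT**: `(y, y′) ↦ (φ y, φ y′)` preserves it (the pair of `a` at `j` goes to the pair of
`a^p` at `j`; E-t3's `pt_frob`, Prop. 6.6.1). DERIVED — this is what lets it descend to `X = Y/φ^ℤ` («resp. `X ⇢ X`»).
[claim: Joshi2023ATS2Local, status: disputed] -/
theorem heckeCorr_frob {y y' : Y} (h : (y, y') ∈ P.heckeCorr) : (P.frobY y, P.frobY y') ∈ P.heckeCorr := by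
  obtain ⟨a, ha, i, hq⟩ := h
  obtain ⟨rfl, rfl⟩ := Prod.mk.inj hq
  refine ⟨a ^ P.p, P.pow_mem_ansatzParam ha P.p_prime.ne_zero, i, ?_⟩
  rw [← P.pt_frob, ansatzPt_eq_pt, ansatzPt_eq_pt, ← P.pt_frob, ← pow_mul, ← pow_mul, mul_comm]

/-- **The correspondence is GALOIS-EQUIVARIANT**: `(y, y′) ↦ (σ y, σ y′)` preserves it (§6.7: «`σ([a^{j²}] − p) = [σ(a)^{j²}] − p`»;
E-t3's `pt_gal`, `absF_galF`). DERIVED. [claim: Joshi2023ATS2Local, status: disputed] -/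
theorem heckeCorr_gal (g : G) {y y' : Y} (h : (y, y') ∈ P.heckeCorr) : (P.galY g y, P.galY g y') ∈ P.heckeCorr := by
  obtain ⟨a, ha, i, hq⟩ := h
  obtain ⟨rfl, rfl⟩ := Prod.mk.inj hq
  have hga : P.galF g a ∈ P.AnsatzParam := by
    refine ⟨fun h0 => ha.1 ?_, by rw [P.absF_galF]; exact ha.2⟩
    have := P.absF_galF g a
    rw [h0, map_zero] at this
    exact (map_eq_zero P.absF).1 this.symm
  refine ⟨P.galF g a, hga, i, ?_⟩
  rw [← P.pt_gal, ansatzPt_eq_pt, ansatzPt_eq_pt, ← P.pt_gal, map_pow]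

/-- **Rmk. 6.6.2 «resp. `X ⇢ X`» — the descended correspondence on `X`**: the image of `heckeCorr` under `Y × Y → X × X`. DEFINITION.
[claim: Joshi2023ATS2Local, status: disputed] -/
def heckeCorrX : Set (P.XPt × P.XPt) := {q | ∃ y y' : Y, (y, y') ∈ P.heckeCorr ∧ q = (P.toX y, P.toX y')}

/-- Related points of `Y` have related images in `X`. [folklore] -/
theorem toX_mem_heckeCorrX {y y' : Y} (h : (y, y') ∈ P.heckeCorr) : (P.toX y, P.toX y') ∈ P.heckeCorrX :=
  ⟨y, y', h, rfl⟩

/-- The descent is compatible with Frobenius: a related pair and its `φ`-translate (again related, `heckeCorr_frob`) give the SAME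
pair in `X × X`. DERIVED. [claim: Joshi2023ATS2Local, status: disputed] -/
theorem toX_pair_frobY (y y' : Y) : (P.toX (P.frobY y), P.toX (P.frobY y')) = (P.toX y, P.toX y') := by
  rw [P.toX_frobY, P.toX_frobY]

/-- Every pair of `heckeCorrX` is the image of a related pair of `Y` all of whose forward `φ`-translates are related and lie over it.
DERIVED. [claim: Joshi2023ATS2Local, status: disputed] -/
theorem exists_lift_of_mem_heckeCorrX {x x' : P.XPt} (h : (x, x') ∈ P.heckeCorrX) :
    ∃ y y' : Y, (∀ n : ℕ, (P.frobY^[n] y, P.frobY^[n] y') ∈ P.heckeCorr) ∧ P.toX y = x ∧ P.toX y' = x' := by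
  obtain ⟨y, y', hyy', hq⟩ := h
  obtain ⟨rfl, rfl⟩ := Prod.mk.inj hq
  refine ⟨y, y', fun n => ?_, rfl, rfl⟩
  induction n with
  | zero => exact hyy'
  | succ n ih =>
    rw [Function.iterate_succ_apply', Function.iterate_succ_apply']
    exact P.heckeCorr_frob ih

/-- **The correspondence RESCALES VALUATIONS BY SQUARES** (Rmk. 6.6.2 read with Thm. 6.9.1, E-t3's `scale_ansatzPt`: «`v_{K_j}(p) =
j²·v_{K_1}(p)`»): if `(y, y′) ∈ heckeCorr` then `scale y′ = j²·scale y` for some `1 ≤ j ≤ ℓ⋆`. DERIVED. (Block-E record: this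
rescaling at each label `j` is the move the slot's test located outside `⟨(Ind1) ∪ (Ind2)⟩` at the pinned countermodel —
`Joshi/TestATS2Reading`.) [claim: Joshi2023ATS2Local, status: disputed] -/
theorem exists_scale_eq_sq_mul {y y' : Y} (h : (y, y') ∈ P.heckeCorr) :
    ∃ j : ℕ, 1 ≤ j ∧ j ≤ P.lstar ∧ P.scale y' = ((j ^ 2 : ℕ) : ℝ) * P.scale y := by
  obtain ⟨a, ha, i, hq⟩ := h
  obtain ⟨rfl, rfl⟩ := Prod.mk.inj hq
  exact ⟨(i : ℕ) + 1, Nat.succ_le_succ (Nat.zero_le _), i.isLt, P.scale_ansatzPt ha i⟩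

/-- In particular the correspondence never DECREASES the scaling exponent: `scale y ≤ scale y′`. DERIVED. [claim: Joshi2023ATS2Local, status: disputed] -/
theorem scale_le_of_mem_heckeCorr {y y' : Y} (h : (y, y') ∈ P.heckeCorr) : P.scale y ≤ P.scale y' := by
  obtain ⟨j, hj, -, hs⟩ := P.exists_scale_eq_sq_mul h
  rw [hs]
  have h1 : (1 : ℝ) ≤ ((j ^ 2 : ℕ) : ℝ) := by exact_mod_cast Nat.one_le_pow 2 j hj
  exact le_mul_of_one_le_left (P.scale_pos y).le h1

end PrototypeDatum

end Summit.ABC.IUTFork.Joshi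

end
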